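import Summits.BirchSwinnertonDyer.BirchSwinnertonDyer.Theorems.SignedLowerHalvesSmallImageLowerHalfBothSignsRttCharRoadCoordinatesAdapted
import Summits.BirchSwinnertonDyer.BirchSwinnertonDyer.Theorems.SignedLowerHalvesSmallImageLowerHalfBothSignsRttCharRoadDivisibleEnd
import HarnessLib

/-!
# Route `SignedLowerHalves`, crux L `SmallImageLowerHalfBothSigns` (stmt-BirchSwinnertonDyer-23599), line `rtt_w3` v12 — row T-2 / J-loc′ of INJ_top:
# the α-lane clauses `hw` (a NON-SCALAR Galois element on `W_K[p]`) and `hfaith` (`u_d` kills `W_K[p]` only if `p ∣ d`)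

Hand `bsd-inputs-honda-p1` g20 (LEAD `cruxlead-stmt-BirchSwinnertonDyer-23599` g7; asked by width seat `bsd-line-slh-p3-w3` g18 10:59Z / 11:04Z);
helper `--supports stmt-BirchSwinnertonDyer-23599`; THEOREMS ONLY (no definition, no named fact, no instance, no `sorry`).
BSD / crux L / INJ_top / T-2 are NOT proved here.

Both clauses are read off row J-curve's `𝒪_v`-semilinear bijection `α : W_K[p^∞] → K_v ⧸ 𝒪_v` (`…RttCharRoadTorsionModule.exists_torsionModule`:
`α (u b t) = e_v b • α t`) at the single test point `x := α⁻¹ [p⁻¹] ∈ W_K[p]`:  `u_b x = n • x ↔ p ∣ b − n` and `u_d x = 0 ↔ p ∣ d` in `𝒪_v`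
(`smul_mk_inv_natCast_eq_zero_iff`).  At the inert `v = (p)` of the quadratic `K` the residue field `𝒪_v/(p)` has `p² > p` elements
(`natCard_residueField_adicCompletionIntegers_eq_sq`), so some unit `b ∈ 𝒪_v` is NOT congruent to a rational integer mod `p`; with `χ_{−p}` onto
`𝒪_v^×` this gives ★ `exists_nonscalar_galois` (`hw`), and ★ `exists_eq_natCast_mul_of_forall_torsion` is `hfaith`.  Both are stated for ANY data
`(u, χ, α)` with the listed laws, so they apply verbatim to the `u` of `exists_torsionModule` / `exists_coordinates_inputs(_adapted)`.

References: [SilvermanAEC2009] III.6.4 (b), VII.2; [LubinTate1965] §2 Thm. 2 and Cor.; [NeukirchANT1999] Ch. II §5; [Kobayashi2003] §8.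
-/

set_option autoImplicit false
-- D-0017: single-problem summit, the namespace repeats the problem name by design.
set_option linter.dupNamespace false
noncomputable section

open scoped Classical NumberField
open NumberField IsDedekindDomain IsDedekindDomain.HeightOneSpectrum Field ValuativeRel
  Literature.NumberTheory.EllipticCurves Literature.NumberTheory.GaloisRepresentations Literature.NumberTheory.NumberFields
  Literature.NumberTheory.GaloisRepresentations.IsNonarchimedeanLocalField

namespace Summit.BirchSwinnertonDyer.BirchSwinnertonDyer.Theorems.SmallImageRttCharRoad

section Witness

variable {K : Type} [Field K] [NumberField K] (v : HeightOneSpectrum (𝓞 K)) {p : ℕ} [hp : Fact p.Prime]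

omit hp in
/-- `[x] = 0` in `K_v ⧸ 𝒪_v·1` iff `x ∈ 𝒪_v`. [folklore] -/
theorem mk_eq_zero_iff_mem_adicCompletionIntegers (x : v.adicCompletion K) :
    (Submodule.Quotient.mk x : v.adicCompletion K ⧸ Submodule.span (v.adicCompletionIntegers K) {(1 : v.adicCompletion K)}) = 0 ↔
      x ∈ v.adicCompletionIntegers K := by
  rw [Submodule.Quotient.mk_eq_zero, mem_span_adicCompletionIntegers_one_iff]

/-- **The test point `[p⁻¹]`**: for `b ∈ 𝒪_v`, `b • [p⁻¹] = 0` in `K_v ⧸ 𝒪_v` iff `p ∣ b` in `𝒪_v`. [folklore] -/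
theorem smul_mk_inv_natCast_eq_zero_iff (b : v.adicCompletionIntegers K) :
    b • (Submodule.Quotient.mk ((p : v.adicCompletion K)⁻¹) :
      v.adicCompletion K ⧸ Submodule.span (v.adicCompletionIntegers K) {(1 : v.adicCompletion K)}) = 0 ↔
      ((p : ℕ) : v.adicCompletionIntegers K) ∣ b := by
  haveI : CharZero (v.adicCompletion K) := LocalField.charZero_adicCompletion v
  have hp0 : (p : v.adicCompletion K) ≠ 0 := Nat.cast_ne_zero.mpr hp.out.ne_zero
  rw [← Submodule.Quotient.mk_smul, mk_eq_zero_iff_mem_adicCompletionIntegers, Algebra.smul_def]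
  constructor
  · intro h
    refine ⟨⟨_, h⟩, Subtype.ext ?_⟩
    push_cast
    change (b : v.adicCompletion K) = (p : v.adicCompletion K) * ((b : v.adicCompletion K) * (p : v.adicCompletion K)⁻¹)
    rw [mul_comm, mul_assoc, inv_mul_cancel₀ hp0, mul_one]
  · rintro ⟨c, rfl⟩
    push_cast
    change (p : v.adicCompletion K) * (c : v.adicCompletion K) * (p : v.adicCompletion K)⁻¹ ∈ v.adicCompletionIntegers K
    rw [mul_comm, ← mul_assoc, inv_mul_cancel₀ hp0, one_mul]
    exact c.2

/-- `p • [p⁻¹] = 0` in `K_v ⧸ 𝒪_v`. [folklore] -/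
theorem natCast_smul_mk_inv_natCast_eq_zero :
    p • (Submodule.Quotient.mk ((p : v.adicCompletion K)⁻¹) :
      v.adicCompletion K ⧸ Submodule.span (v.adicCompletionIntegers K) {(1 : v.adicCompletion K)}) = 0 := by
  rw [← Nat.cast_smul_eq_nsmul (v.adicCompletionIntegers K), smul_mk_inv_natCast_eq_zero_iff]

omit hp in
/-- At the inert place `v = (p)` of a quadratic field, **some unit of `𝒪_v` is not congruent to a rational integer modulo `p`**: the image of
`ℕ` in the residue field `𝒪_v/(p)` has at most `p` elements while `#(𝒪_v/(p)) = p²`. [cite: NeukirchANT1999, Ch. I §8] -/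
theorem exists_unit_not_congr_natCast [Fact p.Prime] (hK2 : Module.finrank ℚ K = 2) (hv : v.asIdeal = Ideal.span {((p : ℕ) : 𝓞 K)}) :
    ∃ b : v.adicCompletionIntegers K, IsUnit b ∧ ∀ n : ℕ, ¬ ((p : ℕ) : v.adicCompletionIntegers K) ∣ b - n := by
  have hq := natCard_residueField_adicCompletionIntegers_eq_sq v hK2 hv
  have hmax := maximalIdeal_adicCompletionIntegers_eq_span_natCast v hv
  have hpr : Fact p.Prime := inferInstance
  -- the residue field has characteristic `p`
  have hp0 : ((p : ℕ) : IsLocalRing.ResidueField (v.adicCompletionIntegers K)) = 0 := by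
    rw [← map_natCast (IsLocalRing.residue (v.adicCompletionIntegers K)), IsLocalRing.residue_eq_zero_iff, hmax]
    exact Ideal.mem_span_singleton_self _
  haveI : CharP (IsLocalRing.ResidueField (v.adicCompletionIntegers K)) p := (CharP.charP_iff_prime_eq_zero hpr.out).mpr hp0
  -- some residue class is not the class of a rational integer
  have hex : ∃ r : IsLocalRing.ResidueField (v.adicCompletionIntegers K), ∀ n : ℕ, r ≠ n := by
    by_contra h
    push Not at h
    have hsurj : Function.Surjective (fun i : Fin p ↦ ((i : ℕ) : IsLocalRing.ResidueField (v.adicCompletionIntegers K))) := by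
      intro r
      obtain ⟨n, hn⟩ := h r
      refine ⟨⟨n % p, Nat.mod_lt _ hpr.out.pos⟩, ?_⟩
      change ((n % p : ℕ) : IsLocalRing.ResidueField (v.adicCompletionIntegers K)) = r
      rw [hn, ← CharP.cast_eq_mod]
    have hle := Nat.card_le_card_of_surjective _ hsurj
    rw [hq, Nat.card_eq_fintype_card, Fintype.card_fin] at hle
    have hlt : p < p ^ 2 := by nlinarith [hpr.out.one_lt]
    omega
  obtain ⟨r, hr⟩ := hex
  obtain ⟨b, rfl⟩ := IsLocalRing.residue_surjective r
  refine ⟨b, (IsLocalRing.residue_ne_zero_iff_isUnit b).mp (by simpa using hr 0), fun n hn ↦ hr n ?_⟩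
  rw [← sub_eq_zero, ← map_natCast (IsLocalRing.residue (v.adicCompletionIntegers K)), ← map_sub, IsLocalRing.residue_eq_zero_iff, hmax]
  exact Ideal.mem_span_singleton.mpr hn

variable {T : Type*} [AddCommGroup T]

/-- ★ **`hw` — a non-scalar Galois element on `W_K[p]`** (generic form).  Given scalars `u : 𝒪[K_v] → End T` through which a map `χ : Γ → 𝒪[K_v]`
onto the units acts, and an additive bijection `α : T → K_v ⧸ 𝒪_v` with `α (u b t) = e_v b • α t`, at the inert place `v = (p)` of the quadratic `K`
there is `δ₀ ∈ Γ` such that for every `n : ℕ` some `p`-torsion `x ∈ T` has `u (χ δ₀) x ≠ n • x` (namely `x = α⁻¹[p⁻¹]`, `χ δ₀` a unit not congruent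
to a rational integer mod `p`). [cite: LubinTate1965, §2 Thm. 2 and Cor.] [cite: NeukirchANT1999, Ch. II §5] -/
theorem exists_nonscalar_galois (hK2 : Module.finrank ℚ K = 2) (hv : v.asIdeal = Ideal.span {((p : ℕ) : 𝓞 K)})
    {Γ : Type*} (u : 𝒪[v.adicCompletion K] → (T →+ T)) (χ : Γ → 𝒪[v.adicCompletion K])
    (hχsurj : ∀ b : 𝒪[v.adicCompletion K], IsUnit b → ∃ δ : Γ, χ δ = b)
    (α : T →+ (v.adicCompletion K ⧸ Submodule.span (v.adicCompletionIntegers K) {(1 : v.adicCompletion K)}))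
    (hα : Function.Bijective α) (hαu : ∀ (b : 𝒪[v.adicCompletion K]) (t : T), α (u b t) = integerEquivAdicCompletionIntegers v b • α t) :
    ∃ δ₀ : Γ, ∀ n : ℕ, ∃ x : T, p • x = 0 ∧ u (χ δ₀) x ≠ n • x := by
  obtain ⟨b₀, hb₀, hb₀n⟩ := exists_unit_not_congr_natCast v hK2 hv
  obtain ⟨δ₀, hδ₀⟩ := hχsurj ((integerEquivAdicCompletionIntegers v).symm b₀) (hb₀.map _)
  obtain ⟨x, hx⟩ := hα.2 (Submodule.Quotient.mk ((p : v.adicCompletion K)⁻¹))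
  refine ⟨δ₀, fun n ↦ ⟨x, hα.1 ?_, fun h ↦ hb₀n n ?_⟩⟩
  · rw [map_nsmul, map_zero, hx, natCast_smul_mk_inv_natCast_eq_zero]
  · have h' := congrArg α h
    rw [hαu, hδ₀, RingEquiv.apply_symm_apply, map_nsmul, hx, ← Nat.cast_smul_eq_nsmul (v.adicCompletionIntegers K), ← sub_eq_zero,
      ← sub_smul] at h'
    exact (smul_mk_inv_natCast_eq_zero_iff v _).mp h'

/-- ★ **`hfaith` — `u_d` kills the `p`-torsion only if `p ∣ d`** (generic form): with `u`, `α` as in `exists_nonscalar_galois`, if `u d x = 0` for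
every `p`-torsion `x ∈ T` then `d = p · d'` in `𝒪[K_v]` (test at `x = α⁻¹[p⁻¹]`). [cite: SilvermanAEC2009, VII.2] [cite: LubinTate1965, §2 Thm. 2] -/
theorem exists_eq_natCast_mul_of_forall_torsion (u : 𝒪[v.adicCompletion K] → (T →+ T))
    (α : T →+ (v.adicCompletion K ⧸ Submodule.span (v.adicCompletionIntegers K) {(1 : v.adicCompletion K)}))
    (hα : Function.Bijective α) (hαu : ∀ (b : 𝒪[v.adicCompletion K]) (t : T), α (u b t) = integerEquivAdicCompletionIntegers v b • α t)
    (d : 𝒪[v.adicCompletion K]) (hd : ∀ x : T, p • x = 0 → u d x = 0) :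
    ∃ d' : 𝒪[v.adicCompletion K], d = (p : 𝒪[v.adicCompletion K]) * d' := by
  obtain ⟨x, hx⟩ := hα.2 (Submodule.Quotient.mk ((p : v.adicCompletion K)⁻¹))
  have hpx : p • x = 0 := hα.1 (by rw [map_nsmul, map_zero, hx, natCast_smul_mk_inv_natCast_eq_zero])
  have h := congrArg α (hd x hpx)
  rw [hαu, hx, map_zero, smul_mk_inv_natCast_eq_zero_iff] at h
  obtain ⟨c, hc⟩ := h
  refine ⟨(integerEquivAdicCompletionIntegers v).symm c, ?_⟩
  apply (integerEquivAdicCompletionIntegers v).injective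
  rw [hc, map_mul, map_natCast, RingEquiv.apply_symm_apply]

end Witness

end Summit.BirchSwinnertonDyer.BirchSwinnertonDyer.Theorems.SmallImageRttCharRoad

end
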